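import Summits.ValiantsHypothesis.ValiantsHypothesis.Theorems.GrenetZeonDualUnipotentThreeHalvesLongMassPotentialRow
import Summits.ValiantsHypothesis.ValiantsHypothesis.Theorems.GrenetZeonDualUnipotentThreeHalvesLongMassPerPencilPrice

/-!
# `GrenetZeon.TwoDimCoefficients` (stmt-ValiantsHypothesis-8062), stub `stub_dualUnipotent` — the POTENTIAL RUNG:
# a model `per_n = tr(N^{n−1} M)` carries at least `n(n−1) − n·(R(n−1)+Φ)/(D+R)` SHALLOW entries for every potential

8062-side reading of the non-flag certificates of this hand (✓ `PotentialRow.relCert_of_potential`, ✓ `CyclicGrading.relCert_of_cyclicSupport`)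
through the per-pencil price bridge ✓ `PerPencilPrice.le_of_relCert_of_perPoly_eq_trace` (`per_n = tr(N^{n−1}M)` and `RelCert n m N P` force
`n(n−1) ≤ P`).  For EVERY potential `φ : Fin m → ℕ`, `φ ≤ Φ`, that no non-zero entry of `N` raises by more than `R`, and every crash depth `D`
(`D + R ≥ 1`):

  `n(n−1) ≤ n·((R(n−1) + Φ)/(D + R)) + #{non-zero entries (i,j) of N with φ j < φ i + D}`      (★ `le_of_perPoly_eq_trace_potential`).

So the SHALLOW MASS (entries that do not crash by `≥ D`) of any dual-unipotent model of the permanent is `≥ n(n−1) − n(R(n−1)+Φ)/(D+R)`: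
* flag dial `R = 0` (the pencil never raises `φ`): at depth `D` with `Φ/D ≤ (n−1)/2` at least `n(n−1)/2` entries drop `φ` by less than `D`
  (`le_of_perPoly_eq_trace_potential_flag`) — quadratically many SHORT arrows in every flag the pencil respects;
* cyclic dial (ring of `L` levels): at least `n(n−1) − n(n+L−2)/L` non-zero OFF-WRAP entries (`le_of_perPoly_eq_trace_cyclicSupport`); a two-level
  ring model has off-wrap mass `≥ n(n−1) − n²/2 = n(n−2)/2`.
These are unconditional structural facts about width-`m` models of `per_n` in the stub's normal form (no nilpotency used); they do not bound `m`.

Honest framing.  Helper (`--supports stmt-ValiantsHypothesis-8062`); nothing here proves `DualUnipotentBound`, `TwoDimCoefficients`, 24318 or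
`VP ≠ VNP` — OPEN / NOT proved.  Def-free, no sorry. [folklore]
-/

set_option linter.dupNamespace false
set_option autoImplicit false

noncomputable section

namespace Summit.ValiantsHypothesis.ValiantsHypothesis.Theorems.GrenetZeon.PotentialRow

open MvPolynomial Matrix
open scoped BigOperators
open Literature.Computability.AlgebraicComplexity (perPoly)
open Summit.ValiantsHypothesis.ValiantsHypothesis.Cruxes.TwoDimCoefficients.DimTwoCases (AffMat IsAffine)
open Summit.ValiantsHypothesis.ValiantsHypothesis.Theorems.GrenetZeon.SlowCore (RelCert)
open Summit.ValiantsHypothesis.ValiantsHypothesis.Theorems.GrenetZeon.PerPencilPrice (le_of_relCert_of_perPoly_eq_trace)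
open Summit.ValiantsHypothesis.ValiantsHypothesis.Theorems.GrenetZeon.CyclicGrading (relCert_of_cyclicSupport)

variable {n m : ℕ}

/-- ★ **POTENTIAL RUNG.**  `per_n = tr(N^{n−1}·M)` with affine pencils; for every potential `φ ≤ Φ` that no non-zero entry of `N` raises by more than
`R`, and every `D` with `D + R ≥ 1`: `n(n−1) ≤ n·((R(n−1)+Φ)/(D+R)) + #{non-zero entries with φ j < φ i + D}`. [folklore] -/
theorem le_of_perPoly_eq_trace_potential (N M : AffMat n m) (hN : IsAffine N) (hM : IsAffine M)
    (hper : perPoly (Fin n) ℂ = (N ^ (n - 1) * M).trace) (φ : Fin m → ℕ) (Φ R D : ℕ) (hΦ : ∀ i, φ i ≤ Φ) (hDR : 0 < D + R)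
    (hrise : ∀ i j, N i j ≠ 0 → φ i ≤ φ j + R) :
    n * (n - 1) ≤ n * ((R * (n - 1) + Φ) / (D + R)) +
      (Finset.univ.filter fun ij : Fin m × Fin m => N ij.1 ij.2 ≠ 0 ∧ φ ij.2 < φ ij.1 + D).card :=
  le_of_relCert_of_perPoly_eq_trace N M hM hper (relCert_of_potential N hN φ Φ R D hΦ hDR hrise)

/-- ★ **FLAG DIAL of the potential rung** (`R = 0`): if the pencil `N` of a model `per_n = tr(N^{n−1}M)` never raises `φ ≤ Φ`, then for every depth
`D ≥ 1`: `n(n−1) ≤ n·(Φ/D) + #{non-zero entries dropping φ by < D}`. [folklore] -/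
theorem le_of_perPoly_eq_trace_potential_flag (N M : AffMat n m) (hN : IsAffine N) (hM : IsAffine M)
    (hper : perPoly (Fin n) ℂ = (N ^ (n - 1) * M).trace) (φ : Fin m → ℕ) (Φ D : ℕ) (hΦ : ∀ i, φ i ≤ Φ) (hD : 0 < D)
    (hflag : ∀ i j, N i j ≠ 0 → φ i ≤ φ j) :
    n * (n - 1) ≤ n * (Φ / D) + (Finset.univ.filter fun ij : Fin m × Fin m => N ij.1 ij.2 ≠ 0 ∧ φ ij.2 < φ ij.1 + D).card :=
  le_of_relCert_of_perPoly_eq_trace N M hM hper (relCert_of_potential_flag N hN φ Φ D hΦ hD hflag)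

/-- ★ **CYCLIC DIAL of the potential rung**: if the pencil `N` of a model `per_n = tr(N^{n−1}M)` is supported on a ring of `L` levels, then
`n(n−1) ≤ n·((n + L − 2)/L) + #{non-zero off-wrap entries}` — the off-wrap mass of a ring model is at least `n(n−1) − n(n+L−2)/L`. [folklore] -/
theorem le_of_perPoly_eq_trace_cyclicSupport (N M : AffMat n m) (hN : IsAffine N) (hM : IsAffine M)
    (hper : perPoly (Fin n) ℂ = (N ^ (n - 1) * M).trace) {L : ℕ} (lvl : Fin m → ℕ) (hlvl : ∀ i, lvl i < L)
    (hsupp : ∀ i j, N i j ≠ 0 → lvl i = lvl j + 1 ∨ (lvl j + 1 = L ∧ lvl i = 0)) :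
    n * (n - 1) ≤ n * ((n + L - 2) / L) +
      (Finset.univ.filter fun ij : Fin m × Fin m => N ij.1 ij.2 ≠ 0 ∧ lvl ij.2 + 1 ≠ L).card :=
  le_of_relCert_of_perPoly_eq_trace N M hM hper (relCert_of_cyclicSupport N hN lvl hlvl hsupp)

end Summit.ValiantsHypothesis.ValiantsHypothesis.Theorems.GrenetZeon.PotentialRow

end
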